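import Literature.Analysis.FluidPDE.SawtoothClosureMargin
import HarnessLib

/-!
# K3′ `K3NonlinearClosure` (aside, stmt-AnomalousDissipation-20027), line `Localised` — helper for STUB S3
# `stub_k1Localised`: on the sub-box `γ ∈ [5, 8]` it is the route's crux K1loc with the rate `r = γ² − 3`

STUB S3 of the line `Localised` is `K1LocalisedInWindow`: at every box point `γ ∈ [4,8]`, `ρN ∈ {2,…,7}` SOME rate
`r > 1` inside the window `max(ρN, 3e^{σ⋆γ})·(γ²+2) < r²` with `K1Localised ⟨γ,¼,2,1,ρN⟩ r`.  This helper records that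
on the sub-box `[5, 8]` the route's OPEN crux `K1LocalisedCascade` (stmt-AnomalousDissipation-19491: `K1Localised … (γ²−3)`)
supplies it with `r = γ² − 3`: the window at that rate follows from the tree's `SawtoothCascade.closureMargin58_le`
(`3e^{σ⋆γ}‖B(γ)‖ ≤ ⅘(γ²−3)²`) and `‖B(γ)‖ ≥ γ²+1` (`one_add_sq_le_envelope`), since `⅘(γ²+2) < γ²+1`; the `ρN`-branch
is `7(γ²+2) < (γ²−3)²`.  So the content of S3 beyond the crux is exactly the strip `γ ∈ [4, 5)`.  Stated over the
body of the crux's `[5,8]` clause (tree vocabulary; no route-file import).  No definitions, no named facts.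
-/

-- `Summit.<Summit>.<Problem>`: single-conjunct summit, the duplicate namespace segment is deliberate.
set_option linter.dupNamespace false

noncomputable section

namespace Summit.AnomalousDissipation.AnomalousDissipation.Theorems.SawtoothPulseCascade.K3NonlinearClosureLocalised

open Set
open Literature.Analysis.FluidPDE.SawtoothCascade

/-- The S3 window at the crux rate `r = γ² − 3` on `[5, 8]`: `max(ρN, 3e^{σ⋆γ})·(γ² + 2) < (γ² − 3)²` (`ρN ≤ 7`). -/
theorem window58_cruxRate {γ : ℝ} (hγ : γ ∈ Icc (5 : ℝ) 8) {ρN : ℕ} (hρ7 : ρN ≤ 7) :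
    max (ρN : ℝ) (3 * Real.exp (sawSigmaStar * γ)) * (γ ^ 2 + 2) < (γ ^ 2 - 3) ^ 2 := by
  have h5 : (5 : ℝ) ≤ γ := hγ.1
  have hg2 : 0 ≤ γ ^ 2 + 2 := by positivity
  have hρ7' : (ρN : ℝ) ≤ 7 := by exact_mod_cast hρ7
  have hsq : 25 ≤ γ ^ 2 := by nlinarith
  have hrho : (ρN : ℝ) * (γ ^ 2 + 2) < (γ ^ 2 - 3) ^ 2 := by
    calc (ρN : ℝ) * (γ ^ 2 + 2) ≤ 7 * (γ ^ 2 + 2) := mul_le_mul_of_nonneg_right hρ7' hg2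
      _ < (γ ^ 2 - 3) ^ 2 := by nlinarith
  have hmargin := closureMargin58_le hγ
  have henv := one_add_sq_le_envelope γ
  have hE1 : 0 < γ ^ 2 + 1 := by positivity
  have hexp0 : 0 ≤ 3 * Real.exp (sawSigmaStar * γ) := by positivity
  -- `3e^{σγ}(γ²+1) ≤ 3e^{σγ}‖B‖ ≤ ⅘(γ²−3)²`
  have h1 : 3 * Real.exp (sawSigmaStar * γ) * (γ ^ 2 + 1) ≤ 4 / 5 * (γ ^ 2 - 3) ^ 2 := by
    have h := (mul_le_mul_of_nonneg_left henv hexp0).trans hmargin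
    rwa [add_comm (1 : ℝ) (γ ^ 2)] at h
  have hexp : 3 * Real.exp (sawSigmaStar * γ) * (γ ^ 2 + 2) < (γ ^ 2 - 3) ^ 2 := by
    have h2 : 3 * Real.exp (sawSigmaStar * γ) * (γ ^ 2 + 2) ≤ 4 / 5 * (γ ^ 2 - 3) ^ 2 * ((γ ^ 2 + 2) / (γ ^ 2 + 1)) := by
      have e : 3 * Real.exp (sawSigmaStar * γ) * (γ ^ 2 + 2) =
          3 * Real.exp (sawSigmaStar * γ) * (γ ^ 2 + 1) * ((γ ^ 2 + 2) / (γ ^ 2 + 1)) := by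
        field_simp
      rw [e]
      exact mul_le_mul_of_nonneg_right h1 (by positivity)
    have h3 : 4 / 5 * (γ ^ 2 - 3) ^ 2 * ((γ ^ 2 + 2) / (γ ^ 2 + 1)) < (γ ^ 2 - 3) ^ 2 := by
      have hpos : 0 < (γ ^ 2 - 3) ^ 2 := by
        have : 0 < γ ^ 2 - 3 := by nlinarith
        positivity
      have hratio : 4 / 5 * ((γ ^ 2 + 2) / (γ ^ 2 + 1)) < 1 := by
        rw [← mul_div_assoc, div_lt_one hE1]; nlinarith
      calc 4 / 5 * (γ ^ 2 - 3) ^ 2 * ((γ ^ 2 + 2) / (γ ^ 2 + 1))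
          = (4 / 5 * ((γ ^ 2 + 2) / (γ ^ 2 + 1))) * (γ ^ 2 - 3) ^ 2 := by ring
        _ < 1 * (γ ^ 2 - 3) ^ 2 := mul_lt_mul_of_pos_right hratio hpos
        _ = (γ ^ 2 - 3) ^ 2 := one_mul _
    exact lt_of_le_of_lt h2 h3
  rw [max_mul_of_nonneg _ _ hg2]
  exact max_lt hrho hexp

/-- **S3 on the sub-box `[5, 8]` from the crux K1loc.** If `K1Localised ⟨γ,¼,2,1,ρN⟩ (γ²−3)` holds on the box
`[5,8] × {2,…,7}` (the second conjunct of the route's crux `K1LocalisedCascade`, stmt-AnomalousDissipation-19491), then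
`K1LocalisedInWindow` holds there with the rate `r = γ² − 3`. -/
theorem k1LocalisedInWindow58_of_cruxRate
    (h : ∀ γ ∈ Icc (5 : ℝ) 8, ∀ ρN ∈ Finset.Icc 2 7, K1Localised ⟨γ, 1 / 4, 2, 1, ρN⟩ (γ ^ 2 - 3)) :
    ∀ γ ∈ Icc (5 : ℝ) 8, ∀ ρN : ℕ, ρN ∈ Finset.Icc 2 7 → ∃ r : ℝ, 1 < r ∧
      max (ρN : ℝ) (3 * Real.exp (sawSigmaStar * γ)) * (γ ^ 2 + 2) < r ^ 2 ∧
        K1Localised ⟨γ, 1 / 4, 2, 1, ρN⟩ r := by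
  intro γ hγ ρN hρN
  refine ⟨γ ^ 2 - 3, by nlinarith [hγ.1], window58_cruxRate hγ (Finset.mem_Icc.1 hρN).2, h γ hγ ρN hρN⟩

end Summit.AnomalousDissipation.AnomalousDissipation.Theorems.SawtoothPulseCascade.K3NonlinearClosureLocalised

end
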